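import Mathlib
import HarnessLib
import Summits.NavierStokesRegularity.NavierStokesRegularity.Theorems.HalfSpaceWindowDoorCirculationCarryingRigidityConeFluxSubsolution
import Summits.NavierStokesRegularity.NavierStokesRegularity.Theorems.HalfSpaceWindowDoorCirculationCarryingRigidityWholeSpaceMaxPrinciple
import Summits.NavierStokesRegularity.NavierStokesRegularity.Theorems.HalfSpaceWindowDoorCirculationCarryingRigidityAngularMeanDrift
import Literature.Analysis.FluidPDE.MeridianReduction
import Summits.NavierStokesRegularity.NavierStokesRegularity.Theorems.HalfSpaceWindowDoorCirculationCarryingRigidityEddyMeans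
import Summits.NavierStokesRegularity.NavierStokesRegularity.Theorems.HalfSpaceWindowDoorCirculationCarryingRigidityPenalisedMaxPrinciple
import Summits.NavierStokesRegularity.NavierStokesRegularity.Theorems.HalfSpaceWindowDoorCirculationCarryingRigidityFlatTools
import Summits.NavierStokesRegularity.NavierStokesRegularity.Theorems.HalfSpaceWindowDoorCirculationCarryingRigidityFlatTouching

/-!
# Route `HalfSpaceWindowDoor`, crux `CirculationCarryingRigidity` (stmt-NavierStokesRegularity-25311) — line `eddy_covariance`,
# FLAT form of the barrier: the eddy bound is needed only on record far circles that are FLAT, GROWING and η-LOCALLY-MAXIMAL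

LEAD ns-hsw-p1 g10, `--supports 25311 --as helper`; card `Cruxes/…/Lines/eddy_covariance.md`.  `…EddyBarrier.circ_le_of_eddy_aux` run with the
PENALISED form of the maximum principle (`…PenalisedMaxPrinciple.le_of_subsolution_penalised`): the eddy bound `ℛ ≤ (B/√(−t))(∮ω₃ dl + |∮ω_r dl|)`
is consumed only at touching points of the penalised barrier, where `∇(Γ−φ) = 2π·2εe^{K(t−s₀)}x` (`ε ≤ ε₀`, ours) and `∂ₜ(Γ−φ) > 0`; there
`∮ω₃ dl = (4πεe^{K(t−s₀)} + 2κ)r` and `|∮ω_r dl| = 4πεe^{K(t−s₀)}|x₂|`, both `≤ ηr/√(−t)` once `4A ≤ η√(−s₀)` and `ε₀ = ε₀(η,s₀,s₁,Λ,B_up)` is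
small (`…FlatTools.flat_r_bound/flat_z_bound`), and `∂ₜΓ = 2π(∂ₜ(Γ−φ)/2π + ∂ₜφ) > 0`.  RESULT `circ_le_of_flat_aux`: the comparison
`Γ(r,z,s) ≤ μ + π(4K₁+1)r²/(√(−s)√(−s₀))` on `[s₀,s₁]` from the eddy bound required ONLY at times `t ≤ s₁` on RECORD far circles that are FLAT
(`∮ω₃ dl ≤ ηr/√(−t)`, `|∮ω_r dl| ≤ ηr/√(−t)`, any fixed `η > 0`), GROWING (`∂ₜΓ > 0`) and `η`-LOCALLY MAXIMAL (`Γ(r',z',t) ≤ Γ(r,z,t) +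
ηr²/√(−t)` for all `r' ≤ 2r`, `|z' − z| ≤ r`: the global penalised maximum read on nearby circles, `…FlatTools.locmax_bound`).  W6 in `…FlatLiouville`.
WHAT THIS IS NOT: not about NS regularity; HYPOTHETICAL blow-up profiles (KNSS ancient mild solutions).  No item is closed here.
-/

noncomputable section

-- the summit and its single sub-problem share the name (CONVENTIONS §1), as in every Theorems file
set_option linter.dupNamespace false

namespace Summit.NavierStokesRegularity.NavierStokesRegularity.Theorems.HalfSpaceWindowDoorCirculationCarryingRigidityFlatBarrier

open MeasureTheory Set Function Filter Topology InnerProductSpace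
open scoped RealInnerProductSpace InnerProductSpace Laplacian
open Literature.Analysis Literature.Analysis.UnboundedOperators
open Literature.Analysis.FluidPDE hiding eR
open Summit.NavierStokesRegularity.NavierStokesRegularity.Theorems.HalfSpaceWindowDoorCirculationCarryingRigidityDefs
  (InDoorClass SignE3 e3)
open Summit.NavierStokesRegularity.NavierStokesRegularity.Theorems.AxisTwistDoorAveragedConeLiouvilleDefs
  (cylPt eT eR circ vortCirc radVortCirc tiltCirc circleTerm meanR meanZ remainder)
open Summit.NavierStokesRegularity.NavierStokesRegularity.Theorems.AveragedConeLiouville.CircleStokes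
  (deriv_circ_eq_vortCirc)
open Summit.NavierStokesRegularity.NavierStokesRegularity.Theorems.AveragedConeLiouville.CircleCalculus (deriv_circ_z)
open Summit.NavierStokesRegularity.NavierStokesRegularity.Theorems.AveragedConeLiouville.CircMonotone
  (circ_zero circ_mono circ_nonneg vortCirc_nonneg)
open Summit.NavierStokesRegularity.NavierStokesRegularity.Theorems.HalfSpaceWindowDoorCirculationCarryingRigidityAxisCirculation
  (contDiff_circF isSmoothSpaceTimeOn_circF isSmoothSpaceTimeOn_of_class fderiv_circF_eR laplacian_circF hasDerivAt_circF_time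
    contDiffOn_circ)
open Summit.NavierStokesRegularity.NavierStokesRegularity.Theorems.HalfSpaceWindowDoorCirculationCarryingRigidityAngularMeanDrift
  (deriv_circ_s_eq_remainder)
open Summit.NavierStokesRegularity.NavierStokesRegularity.Theorems.HalfSpaceWindowDoorCirculationCarryingRigidityPenalisedMaxPrinciple
  (le_of_subsolution_penalised)
open Summit.NavierStokesRegularity.NavierStokesRegularity.Theorems.HalfSpaceWindowDoorCirculationCarryingRigidityFlatTools
  (barrier_init continuousOn_comparison norm_drift_le flat_r_bound flat_z_bound barrier_slack_nonneg barrier_drift_mono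
    touch_consts touch_z_const locmax_bound far_of_comparison_pos sign_mult cylPt_zero_data)
open Summit.NavierStokesRegularity.NavierStokesRegularity.Theorems.HalfSpaceWindowDoorCirculationCarryingRigidityFlatTouching
  (circ_integrals_of_touching)
open Summit.NavierStokesRegularity.NavierStokesRegularity.Theorems.PoloidalWindowDoorPoloidalWindowRigidityClassSpaceTimeRates
  (exists_fderiv_rate_of_class')

open Summit.NavierStokesRegularity.NavierStokesRegularity.Theorems.HalfSpaceWindowDoorCirculationCarryingRigidityConeFluxSubsolution
variable {C : ℝ} {v : ℝ → EuclideanSpace ℝ (Fin 3) → EuclideanSpace ℝ (Fin 3)}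
open Summit.NavierStokesRegularity.NavierStokesRegularity.Theorems.HalfSpaceWindowDoorCirculationCarryingRigidityEddyMeans
  (abs_meanR_le abs_meanZ_le fderiv_circF_eZ barrier_upper_bound)

set_option maxHeartbeats 4000000 in
/-- **Step 2 with the barrier** (FLAT form): `Γ(r,z,s) ≤ μ + A r²/(√(−s)√(−s₀))` on `[s₀,s₁]`, `μ = sup{Γ(R₁√(−s'),z',s') : s' ≤ s₁}`,
`R₁ = 4(B+C) + R₀ + 1`, `A = π(4K₁+1)`, `12A ≤ η√(−s₀)`, from the EDDY bound `ℛ ≤ (B/√(−t))(∮ω₃ dl + |∮ω_r dl|)` required only at times `≤ s₁`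
on record far circles that are FLAT (`∮ω₃ dl, |∮ω_r dl| ≤ ηr/√(−t)`), GROWING (`∂ₜΓ > 0`) and `η`-LOCALLY MAXIMAL. -/
theorem circ_le_of_flat_aux (hv : InDoorClass C v) (hsign : SignE3 v) {B : ℝ} (hB0 : 0 ≤ B)
    {R₀ : ℝ} (hR₀ : 0 ≤ R₀) {K₁ : ℝ} (hK₁0 : 0 ≤ K₁) (hK₁ : ∀ s < 0, ∀ x, ‖fderiv ℝ (v s) x‖ ≤ K₁ / (-s))
    {s₀ s₁ : ℝ} (hs₀₁ : s₀ < s₁) (hs₁ : s₁ < 0) {η : ℝ} (hη : 0 < η)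
    (hs₀η : 4 * (Real.pi * (4 * K₁ + 1)) ≤ η / 3 * Real.sqrt (-s₀))
    (hed : ∀ t : ℝ, t ≤ s₁ → ∀ r : ℝ, R₀ * Real.sqrt (-t) ≤ r → ∀ z : ℝ,
      (∀ s' : ℝ, s' ≤ t → ∀ z' : ℝ, circ v ((4 * (B + C) + R₀ + 1) * Real.sqrt (-s')) z' s' < circ v r z t) →
      vortCirc v r z t ≤ η * r / Real.sqrt (-t) → |radVortCirc v r z t| ≤ η * r / Real.sqrt (-t) →
      0 < deriv (fun σ => circ v r z σ) t →
      (∀ r' : ℝ, 0 ≤ r' → r' ≤ 2 * r → ∀ z' : ℝ, |z' - z| ≤ r → circ v r' z' t ≤ circ v r z t + η * r ^ 2 / Real.sqrt (-t)) →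
      remainder v r z t ≤ B / Real.sqrt (-t) * (vortCirc v r z t + |radVortCirc v r z t|)) :
    ∀ s ∈ Icc s₀ s₁, ∀ r : ℝ, 0 ≤ r → ∀ z : ℝ,
      circ v r z s ≤ sSup {m : ℝ | ∃ s' : ℝ, s' ≤ s₁ ∧ ∃ z' : ℝ, m = circ v ((4 * (B + C) + R₀ + 1) * Real.sqrt (-s')) z' s'} +
        Real.pi * (4 * K₁ + 1) * r ^ 2 / (Real.sqrt (-s) * Real.sqrt (-s₀)) := by
  set R₁ : ℝ := 4 * (B + C) + R₀ + 1 with hR₁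
  set A : ℝ := Real.pi * (4 * K₁ + 1) with hA
  set S : Set ℝ := {m : ℝ | ∃ s' : ℝ, s' ≤ s₁ ∧ ∃ z' : ℝ, m = circ v (R₁ * Real.sqrt (-s')) z' s'} with hS
  set μ : ℝ := sSup S with hμ
  have hs₀ : s₀ < 0 := hs₀₁.trans hs₁
  have hsq₀ : 0 < Real.sqrt (-s₀) := Real.sqrt_pos.2 (neg_pos.2 hs₀)
  have hsq₁ : 0 < Real.sqrt (-s₁) := Real.sqrt_pos.2 (neg_pos.2 hs₁)
  have hC : 0 ≤ C := HalfSpaceWindowDoorCirculationCarryingRigidityConeFluxSubsolution.typeI_const_nonneg hv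
  have hR₁pos : 0 < R₁ := by positivity
  have hApos : 0 < A := by positivity
  obtain ⟨hSbdd, hSle⟩ := tube_bddAbove hv hR₁pos.le hs₁
  have hμ_ge : ∀ s' ≤ s₁, ∀ z', circ v (R₁ * Real.sqrt (-s')) z' s' ≤ μ := fun s' hs' z' =>
    le_csSup hSbdd ⟨s', hs', z', rfl⟩
  have hμ0 : 0 ≤ μ := by
    refine le_trans ?_ (hμ_ge s₁ le_rfl 0)
    exact circ_nonneg v (contDiff_one_slice hv hs₁) (signE3_atd hsign) hs₁ (by positivity) 0
  have hsm := isSmoothSpaceTimeOn_of_class hv.1 hv.2.1 hv.2.2.1 hv.2.2.2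
  have hsmF := isSmoothSpaceTimeOn_circF hsm
  set F : ℝ → EuclideanSpace ℝ (Fin 3) → ℝ := fun t x => (2 * Real.pi)⁻¹ * circ v (cylRadius x) (x 2) t with hF
  set φ : ℝ → EuclideanSpace ℝ (Fin 3) → ℝ := fun t x =>
    (2 * Real.pi)⁻¹ * (μ + A * (Real.sqrt (-t) * Real.sqrt (-s₀))⁻¹ * (x 0 * x 0 + x 1 * x 1)) with hφ
  set q : ℝ → EuclideanSpace ℝ (Fin 3) → ℝ := fun t x => F t x - φ t x with hq
  -- the sign multiplier `β = ∓B/√(−t)` absorbing `(B/√(−t))|Γ_z|`, and the drift: radial barrier drift + MEAN ADVECTION + `β e_z`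
  set β : ℝ → EuclideanSpace ℝ (Fin 3) → ℝ := fun t x =>
    if 0 ≤ radVortCirc v (cylRadius x) (x 2) t then B / Real.sqrt (-t) else -(B / Real.sqrt (-t)) with hβ
  set b : ℝ → EuclideanSpace ℝ (Fin 3) → EuclideanSpace ℝ (Fin 3) := fun t x =>
    (2 / cylRadius x - B / Real.sqrt (-t) + meanR v (cylRadius x) (x 2) t) • Literature.Analysis.FluidPDE.eR x +
      (meanZ v (cylRadius x) (x 2) t + β t x) • (eZ : EuclideanSpace ℝ (Fin 3)) with hb
  have h2π : 0 < 2 * Real.pi := by positivity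
  have hproj : ∀ (i : Fin 3) (w : EuclideanSpace ℝ (Fin 3)), EuclideanSpace.proj (𝕜 := ℝ) i w = w i := fun i w => rfl
  have hci : ∀ i : Fin 3, ContDiff ℝ 2 fun y : EuclideanSpace ℝ (Fin 3) => y i := fun i =>
    (EuclideanSpace.proj (𝕜 := ℝ) i : EuclideanSpace ℝ (Fin 3) →L[ℝ] ℝ).contDiff
  have hQc : ContDiff ℝ 2 fun y : EuclideanSpace ℝ (Fin 3) => y 0 * y 0 + y 1 * y 1 :=
    ((hci 0).mul (hci 0)).add ((hci 1).mul (hci 1))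
  have hQsq : (fun y : EuclideanSpace ℝ (Fin 3) => y 0 * y 0 + y 1 * y 1) = fun y => y 0 ^ 2 + y 1 ^ 2 := by
    funext y; ring
  have hφ2 : ∀ t, ContDiff ℝ 2 (φ t) := fun t =>
    contDiff_const.mul (contDiff_const.add (contDiff_const.mul hQc))
  have hcontq : ContinuousOn (uncurry q) (Icc s₀ s₁ ×ˢ univ) := continuousOn_comparison hv hs₀₁ hs₁
  have hBup : ∀ t ∈ Icc s₀ s₁, ∀ x, q t x ≤ Real.pi * (C / Real.sqrt (-s₁)) ^ 2 * (-s₀) / (2 * A) :=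
    fun t ht x => barrier_upper_bound hv hμ0 hApos hs₀₁ hs₁ ht x
  have hinit : ∀ x, q s₀ x ≤ 0 := fun x => barrier_init hv hK₁ hμ0 hs₀ x
  -- the drift bound, the penalisation threshold `ε₀`
  set Λ : ℝ := (2 / R₁ + B) / Real.sqrt (-s₁) + C / Real.sqrt (-s₁) + (C / Real.sqrt (-s₁) + B / Real.sqrt (-s₁)) with hΛ
  have hΛ0 : 0 ≤ Λ := by positivity
  set E₁ : ℝ := Real.exp ((2 * Λ + 6) * (s₁ - s₀)) with hE₁
  have hE₁pos : 0 < E₁ := Real.exp_pos _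
  set Bup : ℝ := Real.pi * (C / Real.sqrt (-s₁)) ^ 2 * (-s₀) / (2 * A) with hBupdef
  have hBup0 : 0 ≤ Bup := by
    rw [hBupdef]; exact div_nonneg (mul_nonneg (mul_nonneg Real.pi_pos.le (sq_nonneg _)) (neg_pos.2 hs₀).le) (by positivity)
  have hη3 : 0 < η / 3 := by positivity
  set ε₀ : ℝ := min (η / 3 / (8 * Real.pi * E₁ * Real.sqrt (-s₀))) ((η / 3) ^ 2 / (16 * Real.pi ^ 2 * E₁ ^ 2 * (Bup + 1))) with hε₀
  have hε₀pos : 0 < ε₀ := lt_min (by positivity) (by positivity)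
  have hε₀1 : ε₀ ≤ η / 3 / (8 * Real.pi * E₁ * Real.sqrt (-s₀)) := min_le_left _ _
  have hε₀2 : ε₀ ≤ (η / 3) ^ 2 / (16 * Real.pi ^ 2 * E₁ ^ 2 * (Bup + 1)) := min_le_right _ _
  have hsub : ∀ t ∈ Ioc s₀ s₁, ∀ x, 0 < q t x →
      ‖b t x‖ ≤ Λ ∧
      (∃ U : Set (EuclideanSpace ℝ (Fin 3)), IsOpen U ∧ x ∈ U ∧ ContDiffOn ℝ 2 (q t) U) ∧
      (∃ d : ℝ, HasDerivAt (fun τ => q τ x) d t ∧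
        (0 < d → ∀ ε : ℝ, 0 < ε → ε ≤ ε₀ → ε * (1 + ‖x‖ ^ 2) ≤ q t x - 0 →
          fderiv ℝ (q t) x = ε • (Real.exp ((2 * Λ + 6) * (t - s₀)) • ((2 : ℝ) • innerSL ℝ x)) →
          (∀ y, q t y - ε * (Real.exp ((2 * Λ + 6) * (t - s₀)) * (1 + ‖y‖ ^ 2)) ≤
            q t x - ε * (Real.exp ((2 * Λ + 6) * (t - s₀)) * (1 + ‖x‖ ^ 2))) →
          d + fderiv ℝ (q t) x (b t x) - (Δ (q t)) x ≤ 0)) := by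
    intro t ht x hqpos
    have ht0 : t < 0 := lt_of_le_of_lt ht.2 hs₁
    have hsqt : 0 < Real.sqrt (-t) := Real.sqrt_pos.2 (neg_pos.2 ht0)
    have hv1 := contDiff_one_slice hv ht0
    set ρ := cylRadius x with hρ
    have hρ0 : 0 ≤ ρ := cylRadius_nonneg x
    have hρ2 : ρ ^ 2 = x 0 * x 0 + x 1 * x 1 := by rw [cylRadius_sq x]; ring
    set κ : ℝ := A * (Real.sqrt (-t) * Real.sqrt (-s₀))⁻¹ with hκ
    have hκ0 : 0 ≤ κ := by positivity
    have hρR : R₁ * Real.sqrt (-t) < ρ := far_of_comparison_pos hv hsign ht0 hκ0 (hμ_ge t ht.2 (x 2)) hqpos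
    have hρpos : 0 < ρ := lt_of_le_of_lt (by positivity) hρR
    have hρne : cylRadius x ≠ 0 := hρpos.ne'
    have hρ4B : 4 * (B + C) * Real.sqrt (-t) ≤ ρ := by
      have : 4 * (B + C) * Real.sqrt (-t) ≤ R₁ * Real.sqrt (-t) := by rw [hR₁]; nlinarith [hsqt.le, hR₀]
      exact this.trans hρR.le
    have hmR := abs_meanR_le hv ht0 ρ (x 2)
    have hmZ := abs_meanZ_le hv ht0 ρ (x 2)
    obtain ⟨hβabs, hβmul⟩ : |β t x| = B / Real.sqrt (-t) ∧
        β t x * radVortCirc v ρ (x 2) t = B / Real.sqrt (-t) * |radVortCirc v ρ (x 2) t| := by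
      simp only [hβ, hρ]; exact sign_mult (by positivity)
    refine ⟨?_, ⟨univ, isOpen_univ, mem_univ _, ?_⟩, ?_⟩
    · have h1 := norm_radialDrift_le hB0 hR₁pos hs₁ ht.2 hρR
      have hst : Real.sqrt (-s₁) ≤ Real.sqrt (-t) := Real.sqrt_le_sqrt (by linarith [ht.2])
      have hCt : C / Real.sqrt (-t) ≤ C / Real.sqrt (-s₁) := div_le_div_of_nonneg_left hC hsq₁ hst
      have hBt : B / Real.sqrt (-t) ≤ B / Real.sqrt (-s₁) := div_le_div_of_nonneg_left hB0 hsq₁ hst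
      have h := norm_drift_le x h1 (hmR.trans hCt) (hmZ.trans hCt) ((le_of_eq hβabs).trans hBt)
      simpa only [hb, hρ, hΛ] using h
    · have hF2 : ContDiff ℝ 2 (F t) := contDiff_circF ((hsm.contDiff_slice ht0).of_le (by norm_cast))
      exact (hF2.sub (hφ2 t)).contDiffOn
    · have hF2 : ContDiff ℝ 2 (F t) := contDiff_circF ((hsm.contDiff_slice ht0).of_le (by norm_cast))
      have hFt := hasDerivAt_circF_time hsm ht0 x
      have hlaw := deriv_circ_s_eq_remainder hv.1 hv.2.1 hv.2.2.1 hv.2.2.2 ht0 hρpos (x 2)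
      set D : ℝ := -(-(1 / (2 * Real.sqrt (-t))) * Real.sqrt (-s₀)) / (Real.sqrt (-t) * Real.sqrt (-s₀)) ^ 2 with hDdef
      have hφt : HasDerivAt (fun τ => φ τ x) ((2 * Real.pi)⁻¹ * (A * D * (x 0 * x 0 + x 1 * x 1))) t :=
        ((((hasDerivAt_invSqrt_mul ht0 hs₀).const_mul A).mul_const (x 0 * x 0 + x 1 * x 1)).const_add μ).const_mul
          ((2 * Real.pi)⁻¹)
      have hAD : A * D = κ / (2 * (-t)) := by
        have htt : Real.sqrt (-t) ^ 2 = -t := Real.sq_sqrt (neg_pos.2 ht0).le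
        rw [hκ, hDdef]
        exact barrier_deriv_aux A _ _ _ hsqt hsq₀ htt
      have hQ := HalfSpaceWindowDoorCirculationCarryingRigidityConeFluxSubsolution.hasFDerivAt_horizSq x
      have hφ_has : HasFDerivAt (φ t)
          ((2 * Real.pi)⁻¹ • (κ • ((x 0 • EuclideanSpace.proj (𝕜 := ℝ) (0 : Fin 3) + x 0 • EuclideanSpace.proj (𝕜 := ℝ) (0 : Fin 3)) +
            (x 1 • EuclideanSpace.proj (𝕜 := ℝ) (1 : Fin 3) + x 1 • EuclideanSpace.proj (𝕜 := ℝ) (1 : Fin 3))))) x :=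
        ((hQ.const_mul κ).const_add μ).const_mul ((2 * Real.pi)⁻¹)
      have heR0 : (Literature.Analysis.FluidPDE.eR x) 0 = ρ⁻¹ * x 0 := by
        simp [Literature.Analysis.FluidPDE.eR, hρ]
      have heR1 : (Literature.Analysis.FluidPDE.eR x) 1 = ρ⁻¹ * x 1 := by
        simp [Literature.Analysis.FluidPDE.eR, hρ]
      set a : ℝ := 2 / ρ - B / Real.sqrt (-t) + meanR v ρ (x 2) t with ha
      set c : ℝ := meanZ v ρ (x 2) t + β t x with hc
      have hbdef : b t x = a • Literature.Analysis.FluidPDE.eR x + c • (eZ : EuclideanSpace ℝ (Fin 3)) := by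
        simp only [hb, ha, hc, hρ]
      have heZ0 : (eZ : EuclideanSpace ℝ (Fin 3)) 0 = 0 := by simp [eZ]
      have heZ1 : (eZ : EuclideanSpace ℝ (Fin 3)) 1 = 0 := by simp [eZ]
      have hφ_dir : ∀ a' c' : ℝ, fderiv ℝ (φ t) x (a' • Literature.Analysis.FluidPDE.eR x + c' • (eZ : EuclideanSpace ℝ (Fin 3))) =
          (2 * Real.pi)⁻¹ * (κ * (a' * (2 * ρ))) := by
        intro a' c'
        have hw0 : (a' • Literature.Analysis.FluidPDE.eR x + c' • (eZ : EuclideanSpace ℝ (Fin 3))) 0 = a' * (ρ⁻¹ * x 0) := by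
          rw [PiLp.add_apply, PiLp.smul_apply, PiLp.smul_apply, smul_eq_mul, smul_eq_mul, heR0, heZ0, mul_zero, add_zero]
        have hw1 : (a' • Literature.Analysis.FluidPDE.eR x + c' • (eZ : EuclideanSpace ℝ (Fin 3))) 1 = a' * (ρ⁻¹ * x 1) := by
          rw [PiLp.add_apply, PiLp.smul_apply, PiLp.smul_apply, smul_eq_mul, smul_eq_mul, heR1, heZ1, mul_zero, add_zero]
        rw [hφ_has.fderiv]
        simp only [smul_apply, add_apply, hproj, smul_eq_mul, hw0, hw1]
        have e : x 0 * (a' * (ρ⁻¹ * x 0)) + x 0 * (a' * (ρ⁻¹ * x 0)) +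
            (x 1 * (a' * (ρ⁻¹ * x 1)) + x 1 * (a' * (ρ⁻¹ * x 1))) =
            a' * (2 * (ρ⁻¹ * (x 0 * x 0 + x 1 * x 1))) := by ring
        rw [e, ← hρ2, pow_two, ← mul_assoc ρ⁻¹, inv_mul_cancel₀ hρne, one_mul]
      have hφ_fd : fderiv ℝ (φ t) x (b t x) = (2 * Real.pi)⁻¹ * (κ * (a * (2 * ρ))) := by rw [hbdef]; exact hφ_dir a c
      have hφ_lap : (Δ (φ t)) x = (2 * Real.pi)⁻¹ * (κ * 4) := by
        have e : φ t = (fun _ : EuclideanSpace ℝ (Fin 3) => (2 * Real.pi)⁻¹ * μ) +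
            ((2 * Real.pi)⁻¹ * κ) • (fun y : EuclideanSpace ℝ (Fin 3) => y 0 ^ 2 + y 1 ^ 2) := by
          funext y
          simp only [hφ, hκ, Pi.add_apply, Pi.smul_apply, smul_eq_mul]
          ring
        rw [e]
        have hc1 : ContDiffAt ℝ 2 (fun _ : EuclideanSpace ℝ (Fin 3) => (2 * Real.pi)⁻¹ * μ) x := contDiffAt_const
        have hsq2 : ContDiffAt ℝ 2 (fun y : EuclideanSpace ℝ (Fin 3) => y 0 ^ 2 + y 1 ^ 2) x := by
          rw [← hQsq]; exact hQc.contDiffAt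
        have hc2 : ContDiffAt ℝ 2 (((2 * Real.pi)⁻¹ * κ) • fun y : EuclideanSpace ℝ (Fin 3) => y 0 ^ 2 + y 1 ^ 2) x := by
          rw [Pi.smul_def]; exact hsq2.const_smul ((2 * Real.pi)⁻¹ * κ)
        rw [ContDiffAt.laplacian_add hc1 hc2, InnerProductSpace.laplacian_smul _ hsq2,
          Literature.Analysis.FluidPDE.laplacian_rho x]
        simp [smul_eq_mul]
        ring
      have hFr := fderiv_circF_eR hsm ht0 x
      have hFz := fderiv_circF_eZ hsm ht0 hρne
      have hFΔ := laplacian_circF hsm ht0 hρne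
      have hFb : fderiv ℝ (F t) x (b t x) = a * ((2 * Real.pi)⁻¹ * vortCirc v ρ (x 2) t) +
          c * (-((2 * Real.pi)⁻¹ * radVortCirc v ρ (x 2) t)) := by
        rw [hbdef, map_add, map_smul, map_smul, smul_eq_mul, smul_eq_mul]
        show a * fderiv ℝ (F t) x (Literature.Analysis.FluidPDE.eR x) + c * fderiv ℝ (F t) x eZ = _
        rw [hFr, hFz]
      have hΔq : (Δ (q t)) x = (Δ (F t)) x - (Δ (φ t)) x :=
        ContDiffAt.laplacian_sub hF2.contDiffAt (hφ2 t).contDiffAt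
      have hDq : fderiv ℝ (q t) x (b t x) = fderiv ℝ (F t) x (b t x) - fderiv ℝ (φ t) x (b t x) := by
        have e : q t = fun y => F t y - φ t y := rfl
        rw [e, fderiv_fun_sub ((hF2.differentiable (by norm_num)).differentiableAt) hφ_has.differentiableAt]
        rfl
      have hFΔ' : (Δ (F t)) x = (2 * Real.pi)⁻¹ * (deriv (fun r' => deriv (fun r'' => circ v r'' (x 2) t) r') ρ
          + ρ⁻¹ * deriv (fun r' => circ v r' (x 2) t) ρ
          + deriv (fun z' => deriv (fun z'' => circ v ρ z'' t) z') (x 2)) := hFΔ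
      rw [← hρ] at hFt
      refine ⟨_, hFt.sub hφt, fun hdpos ε hε hεε₀ hεq hgradq hglob => ?_⟩
      -- ### flatness and growth at the touching point
      set E : ℝ := Real.exp ((2 * Λ + 6) * (t - s₀)) with hE
      have hEpos : 0 < E := Real.exp_pos _
      have hEE₁ : E ≤ E₁ := Real.exp_le_exp.2 (mul_le_mul_of_nonneg_left (sub_le_sub_right ht.2 s₀) (by positivity))
      have hgrad' : fderiv ℝ (fun y : EuclideanSpace ℝ (Fin 3) =>
          (2 * Real.pi)⁻¹ * circ v (cylRadius y) (y 2) t - (2 * Real.pi)⁻¹ * (μ + κ * (y 0 * y 0 + y 1 * y 1))) x =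
          ε • (E • ((2 : ℝ) • innerSL ℝ x)) := by
        have e : (fun y : EuclideanSpace ℝ (Fin 3) =>
            (2 * Real.pi)⁻¹ * circ v (cylRadius y) (y 2) t - (2 * Real.pi)⁻¹ * (μ + κ * (y 0 * y 0 + y 1 * y 1))) = q t := by
          funext y; simp only [hq, hF, hφ, hκ]
        rw [e, hgradq]
      obtain ⟨hΓr_eq, hΓz_eq⟩ := circ_integrals_of_touching hv ht0 hρne hgrad'
      rw [← hρ] at hΓr_eq hΓz_eq
      have hweak : η / 3 * ρ / Real.sqrt (-t) ≤ η * ρ / Real.sqrt (-t) :=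
        div_le_div_of_nonneg_right (mul_le_mul_of_nonneg_right (by linarith) hρ0) hsqt.le
      have hflatR : vortCirc v ρ (x 2) t ≤ η * ρ / Real.sqrt (-t) := by
        rw [hΓr_eq]
        exact (flat_r_bound hρ0 ht0 ht.1.le hκ hs₀η hη3 hε.le hεε₀ hEpos.le hEE₁ hE₁pos hε₀1).trans hweak
      have hflatZ : |radVortCirc v ρ (x 2) t| ≤ η * ρ / Real.sqrt (-t) := by
        have hx2 : |x 2| ≤ ‖x‖ := by simpa using PiLp.norm_apply_le x 2
        have hq_le : q t x ≤ Bup := hBup t ⟨ht.1.le, ht.2⟩ x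
        have hεq' : ε * (1 + ‖x‖ ^ 2) ≤ Bup := by rw [sub_zero] at hεq; exact hεq.trans hq_le
        have hρσ : Real.sqrt (-t) ≤ ρ := by
          have hR₁1 : 1 ≤ R₁ := by rw [hR₁]; exact le_add_of_nonneg_left (by positivity)
          exact (le_mul_of_one_le_left hsqt.le hR₁1).trans hρR.le
        rw [hΓz_eq, abs_neg, abs_mul, abs_of_nonneg (by positivity : 0 ≤ 4 * Real.pi * ε * E)]
        exact (flat_z_bound ht0 hη3 (norm_nonneg x) hx2 hε.le hεε₀ hεq' hBup0 hEpos.le hEE₁ hE₁pos hε₀2 hρσ).trans hweak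
      -- local maximality: the global penalised maximum read on the circles `(r', z')`, `r' ≤ 2ρ`, `|z' − x₂| ≤ ρ`
      have hlocmax : ∀ r' : ℝ, 0 ≤ r' → r' ≤ 2 * ρ → ∀ z' : ℝ, |z' - x 2| ≤ ρ →
          circ v r' z' t ≤ circ v ρ (x 2) t + η * ρ ^ 2 / Real.sqrt (-t) := by
        intro r' hr' hr'2 z' hz'
        obtain ⟨hκ2, hεE⟩ := touch_consts ht0 ht.1.le hκ hs₀η hε.le hεε₀ hEpos.le hEE₁ hE₁pos hε₀1
        have hx2 : |x 2| ≤ ‖x‖ := by simpa using PiLp.norm_apply_le x 2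
        have hq_le : q t x ≤ Bup := hBup t ⟨ht.1.le, ht.2⟩ x
        have hεq' : ε * (1 + ‖x‖ ^ 2) ≤ Bup := by rw [sub_zero] at hεq; exact hεq.trans hq_le
        have hzc := touch_z_const hη3 (norm_nonneg x) hx2 hε.le hεε₀ hεq' hBup0 hEpos.le hEE₁ hE₁pos hε₀2
        have hρσ : Real.sqrt (-t) ≤ ρ := by
          have hR₁1 : 1 ≤ R₁ := by rw [hR₁]; exact le_add_of_nonneg_left (by positivity)
          exact (le_mul_of_one_le_left hsqt.le hR₁1).trans hρR.le
        -- the point `y = cylPt r' 0 z'`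
        have hy := hglob (cylPt r' 0 z')
        obtain ⟨hrad, hy2, hy01, hyn⟩ := cylPt_zero_data hr' z'
        have hxn : ‖x‖ ^ 2 = ρ ^ 2 + x 2 ^ 2 := by rw [EuclideanSpace.real_norm_sq_eq, Fin.sum_univ_three, hρ, cylRadius_sq]
        have hineq : (2 * Real.pi)⁻¹ * (circ v r' z' t - (μ + κ * (r' ^ 2))) - ε * (E * (1 + (r' ^ 2 + z' ^ 2))) ≤
            (2 * Real.pi)⁻¹ * (circ v ρ (x 2) t - (μ + κ * (ρ ^ 2))) - ε * (E * (1 + (ρ ^ 2 + x 2 ^ 2))) := by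
          have e1 : q t (cylPt r' 0 z') = (2 * Real.pi)⁻¹ * (circ v r' z' t - (μ + κ * (r' ^ 2))) := by
            show (2 * Real.pi)⁻¹ * circ v (cylRadius (cylPt r' 0 z')) ((cylPt r' 0 z') 2) t -
              (2 * Real.pi)⁻¹ * (μ + A * (Real.sqrt (-t) * Real.sqrt (-s₀))⁻¹ *
                ((cylPt r' 0 z') 0 * (cylPt r' 0 z') 0 + (cylPt r' 0 z') 1 * (cylPt r' 0 z') 1)) = _
            rw [hrad, hy2, hy01, ← hκ]; ring
          have e2 : q t x = (2 * Real.pi)⁻¹ * (circ v ρ (x 2) t - (μ + κ * (ρ ^ 2))) := by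
            show (2 * Real.pi)⁻¹ * circ v (cylRadius x) (x 2) t -
              (2 * Real.pi)⁻¹ * (μ + A * (Real.sqrt (-t) * Real.sqrt (-s₀))⁻¹ * (x 0 * x 0 + x 1 * x 1)) = _
            rw [← hρ, ← hρ2, ← hκ]; ring
          rw [← e1, ← e2, ← hyn, ← hxn]
          exact hy
        have h := locmax_bound ht0 hη3 hκ0 hε.le hEpos.le hρσ hr' hr'2 hz' hineq hκ2 hεE hzc
        have e3 : 3 * (η / 3) * ρ ^ 2 / Real.sqrt (-t) = η * ρ ^ 2 / Real.sqrt (-t) := by ring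
        rw [e3] at h
        exact h
      -- growth: `∂ₜΓ = 2π(d + ∂ₜφ) > 0`
      have hgrow : 0 < deriv (fun σ => circ v ρ (x 2) σ) t := by
        have hφt0 : 0 ≤ (2 * Real.pi)⁻¹ * (A * D * (x 0 * x 0 + x 1 * x 1)) := by
          rw [show A * D * (x 0 * x 0 + x 1 * x 1) = (A * D) * (x 0 * x 0 + x 1 * x 1) by ring, hAD, ← hρ2]
          have h2t : 0 < 2 * (-t) := mul_pos two_pos (neg_pos.2 ht0)
          exact mul_nonneg (by positivity) (mul_nonneg (div_nonneg hκ0 h2t.le) (sq_nonneg _))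
        have h' := add_pos_of_pos_of_nonneg hdpos hφt0
        rw [sub_add_cancel] at h'
        exact (mul_pos_iff_of_pos_left (by positivity : (0:ℝ) < (2 * Real.pi)⁻¹)).1 h'
      have hρR₀ : R₀ * Real.sqrt (-t) ≤ ρ := by
        have : R₀ * Real.sqrt (-t) ≤ R₁ * Real.sqrt (-t) := by rw [hR₁]; nlinarith [hsqt.le]
        exact this.trans hρR.le
      have hΓμ : μ < circ v ρ (x 2) t := by
        have e : q t x = (2 * Real.pi)⁻¹ * (circ v ρ (x 2) t - (μ + κ * (x 0 * x 0 + x 1 * x 1))) := by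
          show (2 * Real.pi)⁻¹ * circ v ρ (x 2) t -
              (2 * Real.pi)⁻¹ * (μ + A * (Real.sqrt (-t) * Real.sqrt (-s₀))⁻¹ * (x 0 * x 0 + x 1 * x 1)) = _
          rw [hκ]; ring
        have hq' : 0 < (2 * Real.pi)⁻¹ * (circ v ρ (x 2) t - (μ + κ * (x 0 * x 0 + x 1 * x 1))) := by rw [← e]; exact hqpos
        have hQ0 : 0 ≤ κ * (x 0 * x 0 + x 1 * x 1) := by rw [← hρ2]; positivity
        have := (mul_pos_iff_of_pos_left (by positivity : (0:ℝ) < (2 * Real.pi)⁻¹)).1 hq'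
        linarith
      have hStep1 := hed t ht.2 ρ hρR₀ (x 2) (fun s' hs' z' => lt_of_le_of_lt (hμ_ge s' (hs'.trans ht.2) z') hΓμ)
        hflatR hflatZ hgrow hlocmax
      have hΓr0 : 0 ≤ vortCirc v ρ (x 2) t := vortCirc_nonneg v (signE3_atd hsign) ht0 hρ0 _
      have hΓr' : deriv (fun r' => circ v r' (x 2) t) ρ = vortCirc v ρ (x 2) t := deriv_circ_eq_vortCirc v hv1 ρ (x 2)
      rw [hDq, hΔq, hFb, hφ_fd, hφ_lap, hFΔ', hlaw, hΓr']
      set Γr := vortCirc v ρ (x 2) t with hΓr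
      set ϱ := radVortCirc v ρ (x 2) t with hϱ
      set Γrr := deriv (fun r' => deriv (fun r'' => circ v r'' (x 2) t) r') ρ
      set Γzz := deriv (fun z' => deriv (fun z'' => circ v ρ z'' t) z') (x 2)
      set Rm := remainder v ρ (x 2) t with hRm
      set mR := meanR v ρ (x 2) t with hmRdef
      set mZ := meanZ v ρ (x 2) t with hmZdef
      -- the barrier beats the radial inward speed `(B + C)/√(−t)` outside the tube; the mean radial advection `v̄_r φ_r ≥ −(C/√(−t))φ_r`
      have hbar := barrier_slack_nonneg (X := x 0 * x 0 + x 1 * x 1) ht0 hκ0 hρpos hρ2.symm hAD hρ4B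
      have hmean_bar : (2 * Real.pi)⁻¹ * (κ * ((2 / ρ - (B + C) / Real.sqrt (-t)) * (2 * ρ))) ≤
          (2 * Real.pi)⁻¹ * (κ * (a * (2 * ρ))) := by
        refine barrier_drift_mono hκ0 hρ0 ?_
        rw [ha]
        have := (abs_le.1 hmR).1
        have e : (B + C) / Real.sqrt (-t) = B / Real.sqrt (-t) + C / Real.sqrt (-t) := by rw [add_div]
        linarith
      -- the eddy hypothesis and the multiplier `β`
      have hT : Rm ≤ B / Real.sqrt (-t) * (Γr + |ϱ|) := hStep1
      have hβϱ : β t x * ϱ = B / Real.sqrt (-t) * |ϱ| := hβmul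
      have hcϱ : c * ϱ = mZ * ϱ + B / Real.sqrt (-t) * |ϱ| := by rw [hc, add_mul, hβϱ]
      have key : (2 * Real.pi)⁻¹ * (Γrr - ρ⁻¹ * Γr + Γzz + Rm - mR * Γr + mZ * ϱ) - (2 * Real.pi)⁻¹ * (A * D * (x 0 * x 0 + x 1 * x 1)) +
          (a * ((2 * Real.pi)⁻¹ * Γr) + c * (-((2 * Real.pi)⁻¹ * ϱ)) - (2 * Real.pi)⁻¹ * (κ * (a * (2 * ρ)))) -
          ((2 * Real.pi)⁻¹ * (Γrr + ρ⁻¹ * Γr + Γzz) - (2 * Real.pi)⁻¹ * (κ * 4)) =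
          (2 * Real.pi)⁻¹ * (Rm - B / Real.sqrt (-t) * (Γr + |ϱ|)) -
          ((2 * Real.pi)⁻¹ * (A * D * (x 0 * x 0 + x 1 * x 1))
            + (2 * Real.pi)⁻¹ * (κ * (a * (2 * ρ))) - (2 * Real.pi)⁻¹ * (κ * 4)) := by
        rw [show c * (-((2 * Real.pi)⁻¹ * ϱ)) = -((2 * Real.pi)⁻¹ * (c * ϱ)) by ring, hcϱ, ha]
        field_simp
        ring
      rw [key]
      have h1 : (2 * Real.pi)⁻¹ * (Rm - B / Real.sqrt (-t) * (Γr + |ϱ|)) ≤ 0 :=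
        mul_nonpos_of_nonneg_of_nonpos (by positivity) (by linarith)
      linarith
  have hmp := le_of_subsolution_penalised (m := 0) hΛ0 hε₀pos hcontq hBup hinit hsub
  intro s hs r hr z
  have hs0 : s < 0 := lt_of_le_of_lt hs.2 hs₁
  have hsqs : 0 < Real.sqrt (-s) := Real.sqrt_pos.2 (neg_pos.2 hs0)
  have hx := hmp s hs (cylPt r 0 z)
  have hrad : cylRadius (cylPt r 0 z) = r := by
    rw [cylRadius]
    simp [cylPt, Real.sqrt_sq hr]
  have hz : (cylPt r 0 z) 2 = z := by simp [cylPt]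
  have h0 : (cylPt r 0 z) 0 * (cylPt r 0 z) 0 + (cylPt r 0 z) 1 * (cylPt r 0 z) 1 = r ^ 2 := by simp [cylPt]; ring
  have hq' : (2 * Real.pi)⁻¹ * circ v r z s -
      (2 * Real.pi)⁻¹ * (μ + A * (Real.sqrt (-s) * Real.sqrt (-s₀))⁻¹ * r ^ 2) ≤ 0 := by
    change (2 * Real.pi)⁻¹ * circ v (cylRadius (cylPt r 0 z)) ((cylPt r 0 z) 2) s -
      (2 * Real.pi)⁻¹ * (μ + A * (Real.sqrt (-s) * Real.sqrt (-s₀))⁻¹ *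
        ((cylPt r 0 z) 0 * (cylPt r 0 z) 0 + (cylPt r 0 z) 1 * (cylPt r 0 z) 1)) ≤ 0 at hx
    rw [hrad, hz, h0] at hx
    exact hx
  rw [← mul_sub] at hq'
  rcases mul_nonpos_iff.1 hq' with ⟨-, h2⟩ | ⟨h1, -⟩
  · have e : A * (Real.sqrt (-s) * Real.sqrt (-s₀))⁻¹ * r ^ 2 =
        Real.pi * (4 * K₁ + 1) * r ^ 2 / (Real.sqrt (-s) * Real.sqrt (-s₀)) := by
      rw [hA]; field_simp
    linarith
  · exact absurd h1 (not_le.2 (by positivity))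

end Summit.NavierStokesRegularity.NavierStokesRegularity.Theorems.HalfSpaceWindowDoorCirculationCarryingRigidityFlatBarrier

end
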